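import Mathlib
import Summits.Ventures.PercRepro2.SwOutCrossGenKEDefs

/-!
# The fibre data of ANY connected dropped component, EDGE-INDEXED, II: the slab injection, the
core pairs and THE THEOREM (blind cell PercRepro2, night-4 g23, 2026-08-28;
proofs/NIGHT4-G23.md §9)

The remaining axioms of `FibreData` for the fibre of `SwOutCrossGenKEDefs`: the generic slab injection
keeps the blue side clean, avoids the core, improves the label and carries the red atoms
(`psiKE_ok`), is injective through its retraction (`psiInvKE_psiKE`, `psiKE_inj`); the lower core
points (everything dropped, red outside edges) pair with their flips (`coreKE_cases`,
`flip_core0KE`, `pair_labelKE`, `pair_redKE`).  **`fibKE G hG`** is the `FibreData` of a connected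
cross-edge graph `G` on the non-empty vertex set `V`, and **`card_le_crossKE`** — the generic theorem
on it — is the abstract theorem of boundary (iv) for every connected pure dropped component.
-/

namespace Summit.Ventures.PercRepro2

namespace CrossArm

open Classical

variable {V : Type*}

section Psi

variable (G : SimpleGraph V)

/-- The leak, unfolded. -/
lemma leakKE_eq_false_iff (w : FibKE V G) : leakKE G w = false ↔ ∀ i, attE G w i → w.2.2 i = true := by
  simp only [leakKE, decide_eq_false_iff_not, not_exists, not_and]
  constructor
  · intro h i hi
    cases he : w.2.2 i with
    | true => rfl
    | false => exact absurd he (h i hi)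
  · intro h i hi he
    rw [h i hi] at he
    exact Bool.noConfusion he

/-- The core, unfolded. -/
lemma coreKE_eq_true_iff {G : SimpleGraph V} (w : FibKE V G) :
    coreKE w = true ↔ ∃ b, (∀ i, w.1 i = b) ∧ ∀ i, w.2.2 i = b := by
  simp only [coreKE, decide_eq_true_eq]

/-- The generic branch of the slab injection. -/
lemma psiKE_generic {w : FibKE V G} (hex : ¬ ((∀ i, w.1 i = false) ∧ ∀ i, w.2.2 i = true)) :
    psiKE G w = (fun i => !w.1 i, fun s => !w.2.1 s, fun i => w.2.2 i && !decide (attE G w i)) := by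
  simp only [psiKE, if_neg hex]

/-- The exceptional branch of the slab injection. -/
lemma psiKE_exc {w : FibKE V G} (hex : (∀ i, w.1 i = false) ∧ ∀ i, w.2.2 i = true) :
    psiKE G w = (fun _ => true, fun s => !w.2.1 s, fun _ => false) := by
  simp only [psiKE, if_pos hex]

/-- In the generic branch the flip of the image has the u-edge bits and colours of the source. -/
lemma flip_psiKE_generic {w : FibKE V G} (hex : ¬ ((∀ i, w.1 i = false) ∧ ∀ i, w.2.2 i = true)) :
    (psiKE G w).flip = (w.1, w.2.1, fun i => !(w.2.2 i && !decide (attE G w i))) := by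
  rw [psiKE_generic G hex]
  simp only [FibKE.flip, Bool.not_not]

/-- Attachment at the flip of the image is attachment at the source (generic branch). -/
lemma attE_flip_psiKE {w : FibKE V G} (hex : ¬ ((∀ i, w.1 i = false) ∧ ∀ i, w.2.2 i = true)) (i : V) :
    attE G (psiKE G w).flip i ↔ attE G w i := by
  rw [flip_psiKE_generic G hex]
  exact attE_congr G rfl rfl i

/-- **The slab injection keeps the blue side clean, avoids the core, improves the label and carries
the red atoms.** -/
lemma psiKE_ok [Nonempty V] (w : FibKE V G) (hr : leakKE G w = false) (hc : coreKE w = false) :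
    leakKE G (psiKE G w).flip = false ∧ coreKE (psiKE G w) = false ∧
      BetterKE (labelKE G (psiKE G w)) (labelKE G w) ∧
      ∀ a, redKE G w a = true → redKE G (psiKE G w).flip a = true := by
  rw [leakKE_eq_false_iff] at hr
  by_cases hex : (∀ i, w.1 i = false) ∧ ∀ i, w.2.2 i = true
  · -- the exceptional branch: everything dropped, all outside edges blue
    have hpsi := psiKE_exc G hex
    have hnoatt : ∀ i, ¬ attE G w i := not_attE_of_uP_false G hex.1
    refine ⟨?_, ?_, ?_, ?_⟩
    · rw [leakKE_eq_false_iff, hpsi]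
      intro i hi
      exact absurd hi (not_attE_of_uP_false G
        (w := FibKE.flip ((fun _ => true, fun s => !w.2.1 s, fun _ => false) : FibKE V G)) (fun _ => rfl) i)
    · rw [hpsi]
      cases h : coreKE ((fun _ => true, fun s => !w.2.1 s, fun _ => false) : FibKE V G) with
      | false => rfl
      | true =>
        exfalso
        obtain ⟨b, hb1, hb2⟩ := (coreKE_eq_true_iff _).1 h
        obtain ⟨i₀⟩ := ‹Nonempty V›
        have h1 : true = b := hb1 i₀
        have h2 : false = b := hb2 i₀
        rw [← h1] at h2
        exact Bool.noConfusion h2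
    · rw [hpsi]
      refine ⟨fun i _ => rfl, fun i j h => ?_, fun i j h => ?_⟩
      · have h1 : w.2.2 i = false := h.1
        rw [hex.2 i] at h1
        exact Bool.noConfusion h1
      · have h1 : false = true := h.1
        exact Bool.noConfusion h1
    · intro a ha
      exfalso
      cases a with
      | inl i => exact hnoatt i (by simpa [redKE] using ha)
      | inr s =>
        simp only [redKE, decide_eq_true_eq] at ha
        obtain ⟨-, i, -, hi⟩ := ha
        exact hnoatt i hi
  · -- the generic branch
    have hpsi := psiKE_generic G hex
    have hflip := flip_psiKE_generic G hex
    refine ⟨?_, ?_, ?_, ?_⟩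
    · rw [leakKE_eq_false_iff]
      intro i hi
      rw [attE_flip_psiKE G hex] at hi
      rw [hflip]
      show (!(w.2.2 i && !decide (attE G w i))) = true
      simp [hi]
    · cases h : coreKE (psiKE G w) with
      | false => rfl
      | true =>
        exfalso
        rw [hpsi, coreKE_eq_true_iff] at h
        obtain ⟨b, hb1, hb2⟩ := h
        cases b with
        | true =>
          -- everything dropped, and then the outside bits are all blue: the exceptional case
          apply hex
          have huP : ∀ i, w.1 i = false := fun i => by
            have h' : (!w.1 i) = true := hb1 i
            cases hu : w.1 i with
            | false => rfl
            | true => rw [hu] at h'; exact Bool.noConfusion h'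
          refine ⟨huP, fun i => ?_⟩
          have h' : (w.2.2 i && !decide (attE G w i)) = true := hb2 i
          have hna : ¬ attE G w i := not_attE_of_uP_false G huP i
          simp only [hna, decide_false, Bool.not_false, Bool.and_true] at h'
          exact h'
        | false =>
          -- everything attached, hence all outside edges blue: the source is core
          have huP : ∀ i, w.1 i = true := fun i => by
            have h' : (!w.1 i) = false := hb1 i
            cases hu : w.1 i with
            | true => rfl
            | false => rw [hu] at h'; exact Bool.noConfusion h'
          have : coreKE w = true :=
            (coreKE_eq_true_iff w).2 ⟨true, huP, fun i => hr i (attE_of_uP G (huP i))⟩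
          rw [hc] at this
          exact Bool.noConfusion this
    · rw [hpsi]
      refine ⟨fun i hi => ?_, fun i j h => ?_, fun i j h => ?_⟩
      · have hi' : w.2.2 i = false := hi
        show (w.2.2 i && !decide (attE G w i)) = false
        rw [hi']; rfl
      · obtain ⟨hi, hj, -⟩ := h
        have hi' : w.2.2 i = false := hi
        have hj' : w.2.2 j = false := hj
        have hai : ¬ attE G w i := fun ha => by rw [hr i ha] at hi'; exact Bool.noConfusion hi'
        have haj : ¬ attE G w j := fun ha => by rw [hr j ha] at hj'; exact Bool.noConfusion hj'
        refine ⟨?_, ?_, ?_⟩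
        · show (w.2.2 i && !decide (attE G w i)) = false
          rw [hi']; rfl
        · show (w.2.2 j && !decide (attE G w j)) = false
          rw [hj']; rfl
        · -- both unattached, hence both have red u-edges in the image: linked through `u`
          have hui : (!w.1 i) = true := by rw [uP_eq_false_of_not_attE G hai]; rfl
          have huj : (!w.1 j) = true := by rw [uP_eq_false_of_not_attE G haj]; rfl
          exact SimpleGraph.Reachable.trans
            (SimpleGraph.Adj.reachable (show (GlinkE G _).Adj (some i) none from hui))
            (SimpleGraph.Adj.reachable (show (GlinkE G _).Adj none (some j) from huj))
      · obtain ⟨hi, hj, -⟩ := h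
        have hi' : w.2.2 i = true ∧ ¬ attE G w i := by
          have : (w.2.2 i && !decide (attE G w i)) = true := hi
          simpa using this
        have hj' : w.2.2 j = true ∧ ¬ attE G w j := by
          have : (w.2.2 j && !decide (attE G w j)) = true := hj
          simpa using this
        refine ⟨hi'.1, hj'.1, ?_⟩
        -- both have blue u-edges at the source: linked through `u` on the blue side
        have hui : w.flip.1 i = true := by
          show (!w.1 i) = true
          rw [uP_eq_false_of_not_attE G hi'.2]; rfl
        have huj : w.flip.1 j = true := by
          show (!w.1 j) = true
          rw [uP_eq_false_of_not_attE G hj'.2]; rfl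
        exact SimpleGraph.Reachable.trans
          (SimpleGraph.Adj.reachable (show (GlinkE G w.flip).Adj (some i) none from hui))
          (SimpleGraph.Adj.reachable (show (GlinkE G w.flip).Adj none (some j) from huj))
    · intro a ha
      cases a with
      | inl i =>
        simp only [redKE, decide_eq_true_eq] at ha ⊢
        exact (attE_flip_psiKE G hex i).2 ha
      | inr s =>
        simp only [redKE, decide_eq_true_eq] at ha ⊢
        obtain ⟨hcs, i, hi, hatt⟩ := ha
        refine ⟨?_, i, hi, (attE_flip_psiKE G hex i).2 hatt⟩
        rw [hflip]
        exact hcs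

/-- **The retraction recovers a non-core point without red-side leak from its image.** -/
lemma psiInvKE_psiKE (w : FibKE V G) (hr : leakKE G w = false) (hc : coreKE w = false) :
    psiInvKE G (psiKE G w) = w := by
  rw [leakKE_eq_false_iff] at hr
  obtain ⟨uP, c, e⟩ := w
  by_cases hex : (∀ i, (uP, c, e).1 i = false) ∧ ∀ i, (uP, c, e).2.2 i = true
  · rw [psiKE_exc G hex]
    simp only at hex
    have hcond : (∀ i, ((fun _ => true, fun s => !c s, fun _ => false) : FibKE V G).1 i = true) ∧
        ∀ i, ((fun _ => true, fun s => !c s, fun _ => false) : FibKE V G).2.2 i = false :=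
      ⟨fun _ => rfl, fun _ => rfl⟩
    unfold psiInvKE
    rw [if_pos hcond]
    refine Prod.ext ?_ (Prod.ext ?_ ?_)
    · funext i; exact (hex.1 i).symm
    · funext s; exact Bool.not_not (c s)
    · funext i; exact (hex.2 i).symm
  · rw [psiKE_generic G hex]
    simp only at hex
    -- the image is not the exceptional image
    have hcond : ¬ ((∀ i, ((fun i => !uP i, fun s => !c s, fun i => e i && !decide (attE G (uP, c, e) i)) :
        FibKE V G).1 i = true) ∧ ∀ i, ((fun i => !uP i, fun s => !c s,
          fun i => e i && !decide (attE G (uP, c, e) i)) : FibKE V G).2.2 i = false) := by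
      rintro ⟨h1, h2⟩
      simp only at h1 h2
      have huP : ∀ i, uP i = false := fun i => by
        have := h1 i
        cases hu : uP i with
        | false => rfl
        | true => rw [hu] at this; exact Bool.noConfusion this
      have hna : ∀ i, ¬ attE G (uP, c, e) i := not_attE_of_uP_false G huP
      have he : ∀ i, e i = false := fun i => by
        have := h2 i
        simp only [hna i, decide_false, Bool.not_false, Bool.and_true] at this
        exact this
      have : coreKE ((uP, c, e) : FibKE V G) = true := (coreKE_eq_true_iff _).2 ⟨false, huP, he⟩
      rw [hc] at this
      exact Bool.noConfusion this
    unfold psiInvKE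
    rw [if_neg hcond]
    refine Prod.ext ?_ (Prod.ext ?_ ?_)
    · funext i; exact Bool.not_not (uP i)
    · funext s; exact Bool.not_not (c s)
    · funext i
      have hatt : attE G ((fun i => uP i, fun s => c s, fun _ => true) : FibKE V G) i ↔
          attE G (uP, c, e) i :=
        attE_congr G rfl rfl i
      by_cases ha : attE G (uP, c, e) i
      · have h' : e i = true := hr i ha
        simp [ha, hatt, h']
      · simp [ha, hatt]

/-- The slab injection is injective on its domain. -/
lemma psiKE_inj (w w' : FibKE V G) (h : leakKE G w = false) (hc : coreKE w = false)
    (h' : leakKE G w' = false) (hc' : coreKE w' = false) (heq : psiKE G w = psiKE G w') : w = w' := by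
  rw [← psiInvKE_psiKE G w h hc, heq, psiInvKE_psiKE G w' h' hc']

end Psi

section Core0

variable (G : SimpleGraph V) [Fintype V] [DecidableEq V] [DecidableRel G.Adj]

/-- Membership in the lower core points. -/
lemma mem_core0KE {w : FibKE V G} : w ∈ core0KE ↔ (∀ i, w.1 i = false) ∧ ∀ i, w.2.2 i = false := by
  simp only [core0KE, Finset.mem_filter, Finset.mem_univ, true_and]

/-- The lower core points are core. -/
lemma core0KE_core (w : FibKE V G) (hw : w ∈ core0KE) : coreKE w = true :=
  (coreKE_eq_true_iff w).2 ⟨false, ((mem_core0KE G).1 hw).1, ((mem_core0KE G).1 hw).2⟩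

/-- Every core point is a lower core point or the flip of one. -/
lemma coreKE_cases (w : FibKE V G) (hc : coreKE w = true) :
    w ∈ core0KE ∨ ∃ w₀ ∈ core0KE, w = w₀.flip := by
  obtain ⟨b, h1, h2⟩ := (coreKE_eq_true_iff w).1 hc
  cases b with
  | false => exact Or.inl ((mem_core0KE G).2 ⟨h1, h2⟩)
  | true =>
    refine Or.inr ⟨w.flip, (mem_core0KE G).2 ⟨fun i => ?_, fun i => ?_⟩, (FibKE.flip_flip w).symm⟩
    · show (!w.1 i) = false
      rw [h1 i]; rfl
    · show (!w.2.2 i) = false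
      rw [h2 i]; rfl

/-- The flip of a lower core point is not a lower core point. -/
lemma flip_core0KE [Nonempty V] (w : FibKE V G) (hw : w ∈ core0KE) : w.flip ∉ core0KE := by
  intro h
  obtain ⟨i₀⟩ := ‹Nonempty V›
  have h1 : (!w.1 i₀) = false := ((mem_core0KE G).1 h).1 i₀
  have h2 : w.1 i₀ = false := ((mem_core0KE G).1 hw).1 i₀
  rw [h2] at h1
  exact Bool.noConfusion h1

/-- A lower core point has a better label than its flip. -/
lemma pair_labelKE (w : FibKE V G) (hw : w ∈ core0KE) : BetterKE (labelKE G w) (labelKE G w.flip) := by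
  obtain ⟨-, h2⟩ := (mem_core0KE G).1 hw
  refine ⟨fun i _ => h2 i, fun i j h => ?_, fun i j h => ?_⟩
  · have h1 : (!w.2.2 i) = false := h.1
    rw [h2 i] at h1
    exact Bool.noConfusion h1
  · have h1 : w.2.2 i = true := h.1
    rw [h2 i] at h1
    exact Bool.noConfusion h1

/-- The red atoms of a lower core point (none) are red atoms of its flip. -/
lemma pair_redKE (w : FibKE V G) (hw : w ∈ core0KE) (a : AtomKE V G) (ha : redKE G w a = true) :
    redKE G w.flip a = true := by
  exfalso
  obtain ⟨h1, -⟩ := (mem_core0KE G).1 hw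
  have hna := not_attE_of_uP_false G h1
  cases a with
  | inl i =>
    simp only [redKE, decide_eq_true_eq] at ha
    exact hna i ha
  | inr s =>
    simp only [redKE, decide_eq_true_eq] at ha
    obtain ⟨-, i, -, hi⟩ := ha
    exact hna i hi

/-- **The fibre data of any connected pure dropped component.** -/
noncomputable def fibKE [Nonempty V] (hG : G.Connected) :
    FibreData (FibKE V G) (AtomKE V G) (LabelKE V) where
  flip := FibKE.flip
  flip_flip := FibKE.flip_flip
  red := redKE G
  leakR := leakKE G
  core := coreKE
  label := labelKE G
  BetterL := BetterKE
  betterL_refl := BetterKE_refl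
  psi := psiKE G
  core_of_noLeak := coreKE_of_noLeak G hG
  leakR_core := leakKE_core G
  leakR_flip_core := leakKE_flip_core G
  core_flip := coreKE_flip
  psi_ok := psiKE_ok G
  psi_inj := psiKE_inj G
  core0 := core0KE
  core0_core := core0KE_core G
  core_cases := coreKE_cases G
  flip_core0 := flip_core0KE G
  pair_label := pair_labelKE G
  pair_red := pair_redKE G

/-- **THE ABSTRACT THEOREM OF BOUNDARY (iv) FOR EVERY CONNECTED PURE DROPPED COMPONENT**: on every
up-set of types of the cube, the red count is at most the blue count for every up-set of atom
sets. -/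
theorem card_le_crossKE [Nonempty V] (hG : G.Connected) {ι : Type*} [Fintype ι] [DecidableEq ι]
    [Nonempty ι] {𝒯 : Set (TypG (LabelKE V) ι)} (h𝒯 : IsUpG (fibKE G hG) 𝒯)
    {𝓔 : Set (Set (AtomG (AtomKE V G) ι))} (h𝓔 : IsUpperSet 𝓔) :
    ((QG (fibKE G hG) 𝒯).filter fun q => ERG (fibKE G hG) q ∈ 𝓔).card ≤
      ((QG (fibKE G hG) 𝒯).filter fun q => EBG (fibKE G hG) q ∈ 𝓔).card :=
  card_le_crossGen h𝒯 h𝓔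

end Core0

end CrossArm

end Summit.Ventures.PercRepro2
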